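import Literature.Probability.RandomPlanarGeometry.SAWEndpointRateLower
import HarnessLib

/-!
# Kesten's ratio rate, lower side with exponent `1/3`, from a polygon-insertion inequality (abstract lemma)

Topic `Literature/Probability/RandomPlanarGeometry` (continues `SAWEndpointRateLower.lean`: the backward product bound
`KestenRateLower.lower_dev_prod` and the abstract `1/3`-rate lemma `lower_rate_cubeRoot` whose super-multiplicativity input
`a_n a_m ≤ poly · a_{n+m+1}` is specific to walks ending NEXT TO the origin).

Source: N. Madras, G. Slade, *The Self-Avoiding Walk* (1993), §7.5 Notes, eq. (7.5.2) (Kesten 1963): for fixed `x ≠ 0`,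
`-K N^{-1/3} ≤ c_{N+2}(0,x)/c_N(0,x) − μ²` for all large `N` of the parity of `‖x‖₁`.  For a GENERAL endpoint `x` the natural
input is not super-multiplicativity of one sequence but an INSERTION inequality `a_{N'} e_M ≤ poly · a_{N'+2M}` (insert a closed
loop of length `2M`, counted by an auxiliary sequence `e_M` with its own lower envelope `e^{-c√M} μ^{2M} ≤ A e_M`, into a walk of
length `N' ≥ n₁`; Madras–Slade Corollary 3.2.6 / Lemma 7.3.3).  This file proves the corresponding ABSTRACT lemma: with Kesten's
inequality (7.3.3) for all `n ≥ 1` it gives `μ² − a_{N+2}/a_N ≤ K N^{-1/3}` for all `N ≥ 2n₁ + 1` of a fixed parity.  (Backward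
iteration `a_N ≤ (μ² − u/2)^M a_{N−2M}`; insertion at `(N − 2M, M)`: `e_M ≤ poly · (μ² − u/2)^M`; the envelope of `e` gives
`M u ≲ √M + log N`, whence `u ≲ N^{-1/3}` with `M ≍ uN`.)

## What is here (namespace `Literature.Probability.RandomPlanarGeometry.SAW.Zd.KestenRateLower`)

* **`lower_rate_cubeRoot_ins`** — the abstract `1/3`-rate lemma, insertion form.
-/

noncomputable section

open Filter Topology Finset

namespace Literature.Probability.RandomPlanarGeometry.SAW.Zd

namespace KestenRateLower

/-! ### Elementary real lemmas -/

/-- `x ≤ K` from `x² ≤ K`, `K ≥ 1`, `x ≥ 0`. [folklore] -/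
private theorem le_of_sq_le {x K : ℝ} (hx : 0 ≤ x) (hK : 1 ≤ K) (h : x ^ 2 ≤ K) : x ≤ K := by
  by_contra hc
  push Not at hc
  have : K * K < x * x := mul_lt_mul'' hc hc (by linarith) (by linarith)
  nlinarith

/-- `x ≤ K` from `x³ ≤ K`, `K ≥ 1`, `x ≥ 0`. [folklore] -/
private theorem le_of_cube_le {x K : ℝ} (hx : 0 ≤ x) (hK : 1 ≤ K) (h : x ^ 3 ≤ K) : x ≤ K := by
  by_contra hc
  push Not at hc
  have h1 : 1 < x := by linarith
  have : K < x ^ 3 := by nlinarith [mul_lt_mul'' hc hc (by linarith) (by linarith)]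
  linarith

/-- `log x ≤ 3 x^{1/3}` for `x > 0`. [folklore] -/
private theorem log_le_three_rpow_third {x : ℝ} (hx : 0 < x) : Real.log x ≤ 3 * x ^ ((1 : ℝ) / 3) := by
  have h := Real.log_le_sub_one_of_pos (Real.rpow_pos_of_pos hx ((1 : ℝ) / 3))
  rw [Real.log_rpow hx] at h
  linarith

/-- The cube root: `t = N^{1/3}` satisfies `t³ = N`, `t ≥ 1` for `N ≥ 1`, and `N^{-1/3} = t⁻¹`. [folklore] -/
private theorem cubeRoot_facts {N : ℝ} (hN : 1 ≤ N) :
    0 < N ^ ((1 : ℝ) / 3) ∧ 1 ≤ N ^ ((1 : ℝ) / 3) ∧ (N ^ ((1 : ℝ) / 3)) ^ 3 = N ∧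
      N ^ (-(1 : ℝ) / 3) = (N ^ ((1 : ℝ) / 3))⁻¹ := by
  have hN0 : 0 < N := by linarith
  refine ⟨Real.rpow_pos_of_pos hN0 _, Real.one_le_rpow hN (by norm_num), ?_, ?_⟩
  · rw [← Real.rpow_natCast, ← Real.rpow_mul hN0.le]; norm_num
  · rw [show (-(1 : ℝ) / 3) = -((1 : ℝ) / 3) by ring, Real.rpow_neg hN0.le]

/-- `(5N)^{1/3} ≤ 2 N^{1/3}`. [folklore] -/
private theorem rpow_third_five_mul_le {N : ℝ} (hN : 0 ≤ N) : (5 * N) ^ ((1 : ℝ) / 3) ≤ 2 * N ^ ((1 : ℝ) / 3) := by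
  rw [Real.mul_rpow (by norm_num) hN]
  apply mul_le_mul_of_nonneg_right _ (Real.rpow_nonneg hN _)
  have : (5 : ℝ) ^ ((1 : ℝ) / 3) ≤ (8 : ℝ) ^ ((1 : ℝ) / 3) := Real.rpow_le_rpow (by norm_num) (by norm_num) (by norm_num)
  refine this.trans (le_of_eq ?_)
  rw [show (8 : ℝ) = 2 ^ (3 : ℕ) by norm_num, ← Real.rpow_natCast, ← Real.rpow_mul (by norm_num)]; norm_num

/-- Algebra: `μ² − u/2 = μ² (1 − u/(2μ²))`. [folklore] -/
private theorem aux_q (μ u : ℝ) (hμ : 0 < μ) : μ ^ 2 - u / 2 = μ ^ 2 * (1 - u / (2 * μ ^ 2)) := by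
  field_simp

/-- Algebra. [folklore] -/
private theorem aux_A (u N B μ : ℝ) (hB : 0 < B) (hμ : 0 < μ) :
    u * N / (8 * B) * (u / (2 * μ ^ 2)) = u ^ 2 * N / (16 * B * μ ^ 2) := by
  field_simp
  ring

/-- Algebra. [folklore] -/
private theorem aux_B (u N B μ : ℝ) (hB : 0 < B) (hμ : 0 < μ) :
    u * N / (8 * B) * (u / (2 * μ ^ 2)) ^ 2 = u ^ 3 * N / (32 * B * μ ^ 4) := by
  field_simp
  ring

/-- Algebra. [folklore] -/
private theorem aux_y (u N B : ℝ) (hB : 0 < B) : u * N / (4 * B) / 2 = u * N / (8 * B) := by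
  field_simp
  ring



/-! ### The abstract `1/3`-rate lemma, insertion form -/

/-- **Lower deviation rate `N^{-1/3}` from an insertion inequality.** For a positive sequence `a` with Kesten's inequality
(7.3.3) (constant `B ≥ max(1, μ²)`, all `n ≥ 1`), an auxiliary sequence `e` with the lower envelope `e^{-c√M} μ^{2M} ≤ A e_M`
(`M ≥ 2`), and the insertion inequality `a_{N'} e_M ≤ (2(N'+2M)+3)^6 a_{N'+2M}` for `N' ≥ n₁` of parity `r` and `M ≥ 2`:
there is `K` such that for every `N ≥ 2n₁ + 1` of parity `r` and `u > 0` with `a_{N+2}/a_N ≤ μ² − u`, `u ≤ K · N^{-1/3}`.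
[cite: MadrasSlade1993, §7.5, eq. (7.5.2) (Kesten 1963: the exponent 1/3); Lemma 7.3.1; Corollary 3.2.6 (insertion)] -/
theorem lower_rate_cubeRoot_ins {a e : ℕ → ℝ} {μ B c A : ℝ} {n₁ r : ℕ} (ha : ∀ n, 0 < a n) (hμ : 1 ≤ μ)
    (hB1 : 1 ≤ B) (hBμ : μ ^ 2 ≤ B) (hc : 0 ≤ c) (hA : 1 ≤ A)
    (hK : ∀ n : ℕ, 1 ≤ n → a (n + 2) / a n - B / n ≤ a (n + 4) / a (n + 2))
    (hlo : ∀ M : ℕ, 2 ≤ M → Real.exp (-(c * Real.sqrt M)) * μ ^ (2 * M) ≤ A * e M)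
    (hSM : ∀ N' M : ℕ, n₁ ≤ N' → N' % 2 = r → 2 ≤ M →
      a N' * e M ≤ (2 * ((N' : ℝ) + 2 * M) + 3) ^ 6 * a (N' + 2 * M)) :
    ∃ K : ℝ, ∀ N : ℕ, 2 * n₁ + 1 ≤ N → N % 2 = r → ∀ u : ℝ, 0 < u → a (N + 2) / a N ≤ μ ^ 2 - u →
      u ≤ K * (N : ℝ) ^ (-(1 : ℝ) / 3) := by
  have hμ0 : 0 < μ := by linarith
  have hB0 : 0 < B := by linarith
  have hlogμ : 0 ≤ Real.log μ := Real.log_nonneg hμ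
  have hlogA : 0 ≤ Real.log A := Real.log_nonneg hA
  have hA0 : 0 < A := by linarith
  -- the constants
  set KA : ℝ := 32 * B * μ ^ 2 * (36 + Real.log A) with hKA
  set KB : ℝ := 256 * B * μ ^ 4 * c ^ 2 with hKB
  set K : ℝ := max (max 1 KA) (max KB (8 * B)) with hKdef
  have hK1 : 1 ≤ K := le_trans (le_max_left _ _) (le_max_left _ _)
  have hKA_le : KA ≤ K := le_trans (le_max_right _ _) (le_max_left _ _)
  have hKB_le : KB ≤ K := le_trans (le_max_left _ _) (le_max_right _ _)
  have h8B_le : 8 * B ≤ K := le_trans (le_max_right _ _) (le_max_right _ _)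
  refine ⟨K, fun N hN hpar u hu hdev => ?_⟩
  have hN1 : 1 ≤ N := by omega
  have hNr : (1 : ℝ) ≤ N := by exact_mod_cast hN1
  have hN0 : (0 : ℝ) < N := by linarith
  obtain ⟨ht0, ht1, ht3, htinv⟩ := cubeRoot_facts hNr
  set t : ℝ := (N : ℝ) ^ ((1 : ℝ) / 3) with htdef
  rw [htinv]
  -- it suffices to bound `u * t ≤ K`
  rw [← div_eq_mul_inv, le_div_iff₀ ht0]
  -- `u < μ²`
  have hφpos : 0 < a (N + 2) / a N := div_pos (ha _) (ha _)
  have huμ : u < μ ^ 2 := by linarith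
  -- the block count `y = uN/(4B)`
  set y : ℝ := u * N / (4 * B) with hy
  have hy0 : 0 ≤ y := by positivity
  by_cases hsmall : y < 2
  · -- few blocks: `u N < 8 B`, so `u t ≤ 8B t / N ≤ 8 B`
    have h1 : u * N < 8 * B := by
      rw [hy, div_lt_iff₀ (by positivity)] at hsmall; linarith
    have h2 : u * t * t ^ 2 ≤ 8 * B := by
      have : u * t * t ^ 2 = u * N := by rw [← ht3]; ring
      rw [this]; exact h1.le
    have ht2 : 1 ≤ t ^ 2 := one_le_pow₀ ht1
    have : u * t ≤ 8 * B := by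
      have hut : 0 ≤ u * t := by positivity
      nlinarith
    exact this.trans h8B_le
  · push Not at hsmall
    -- `M = ⌊y⌋ ≥ 2`, `M ≤ y < M + 1`
    set M : ℕ := ⌊y⌋₊ with hMdef
    have hMle : (M : ℝ) ≤ y := Nat.floor_le hy0
    have hMlt : y < M + 1 := Nat.lt_floor_add_one y
    have hM2 : 2 ≤ M := by
      have : (2 : ℝ) ≤ M := by
        have := Nat.le_floor (show ((2 : ℕ) : ℝ) ≤ y by exact_mod_cast hsmall)
        exact_mod_cast this
      exact_mod_cast this
    have hMr2 : (2 : ℝ) ≤ M := by exact_mod_cast hM2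
    have hMy : y / 2 ≤ M := by linarith
    -- `4 M B ≤ u N` and `4M ≤ N`
    have h4MB : 4 * (M : ℝ) * B ≤ u * N := by
      have := mul_le_mul_of_nonneg_right hMle (show (0 : ℝ) ≤ 4 * B by positivity)
      rw [hy, div_mul_cancel₀ _ (by positivity)] at this
      linarith
    have h4M : 4 * M ≤ N := by
      have : 4 * (M : ℝ) ≤ N := by
        have h1 : 4 * (M : ℝ) * B ≤ B * N := by
          calc 4 * (M : ℝ) * B ≤ u * N := h4MB
            _ ≤ B * N := mul_le_mul_of_nonneg_right (by linarith) hN0.le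
        have h2 : 4 * (M : ℝ) * B ≤ N * B := by linarith
        exact le_of_mul_le_mul_right h2 hB0
      exact_mod_cast this
    -- `N' = N - 2M ≥ n₁`, of parity `r`
    obtain ⟨N', hN'⟩ : ∃ N', N = N' + 2 * M := ⟨N - 2 * M, by omega⟩
    have hN'1 : n₁ ≤ N' := by omega
    have hN'par : N' % 2 = r := by omega
    have h2M : 2 * M ≤ N' := by omega
    -- the product bound
    rw [hN'] at hdev
    have hprod := lower_dev_prod ha (by linarith) hK (by omega) h2M hu hdev (by push_cast [hN'] at h4MB ⊢; linarith)
    set q : ℝ := μ ^ 2 - u / 2 with hq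
    have hq0 : 0 < q := by rw [hq]; linarith
    -- insertion at `(N', M)`
    have hSM' := hSM N' M hN'1 hN'par hM2
    have ecast : (2 * ((N' : ℝ) + 2 * (M : ℝ)) + 3) = 2 * (N : ℝ) + 3 := by rw [hN']; push_cast; ring
    rw [ecast] at hSM'
    set P : ℝ := (2 * (N : ℝ) + 3) ^ 6 with hP
    have hP1 : 1 ≤ P := one_le_pow₀ (by linarith)
    -- `e M ≤ P q^M`
    have ham : e M ≤ P * q ^ M := by
      have h1 : a N' * e M ≤ P * (q ^ M * a N') := hSM'.trans (mul_le_mul_of_nonneg_left hprod (by positivity))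
      have h2 : a N' * e M ≤ a N' * (P * q ^ M) := by linarith [h1]
      exact le_of_mul_le_mul_left h2 (ha N')
    -- the envelope of `e` at `M`: `e^{-c√M} μ^{2M} ≤ A P μ^{2M} (1 - u/(2μ²))^M`
    have henv := (hlo M hM2).trans (mul_le_mul_of_nonneg_left ham hA0.le)
    -- logs: `-M log(1 - x) ≤ log (A P) + c√M`, `x = u/(2μ²)`
    set x : ℝ := u / (2 * μ ^ 2) with hx
    have hx0 : 0 < x := by positivity
    have hx1 : x < 1 := by
      rw [hx, div_lt_one (by positivity)]
      have : (0 : ℝ) ≤ μ ^ 2 := sq_nonneg μ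
      linarith
    have hqx : q = μ ^ 2 * (1 - x) := by rw [hq, hx]; exact aux_q μ u hμ0
    have hlog1 : (M : ℝ) * -Real.log (1 - x) ≤ Real.log A + Real.log P + c * Real.sqrt M := by
      have hpos1 : 0 < Real.exp (-(c * Real.sqrt M)) * μ ^ (2 * M) := by positivity
      have h := Real.log_le_log hpos1 henv
      have hL : Real.log (Real.exp (-(c * Real.sqrt M)) * μ ^ (2 * M)) = -(c * Real.sqrt M) + (2 * (M : ℝ)) * Real.log μ := by
        rw [Real.log_mul (Real.exp_pos _).ne' (by positivity), Real.log_exp, Real.log_pow]; push_cast; ring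
      have hlogq : Real.log q = 2 * Real.log μ + Real.log (1 - x) := by
        rw [hqx, Real.log_mul (by positivity) (by linarith), Real.log_pow]; push_cast; ring
      have hRlog : Real.log (A * (P * q ^ M)) = Real.log A + Real.log P + (M : ℝ) * (2 * Real.log μ + Real.log (1 - x)) := by
        rw [Real.log_mul hA0.ne' (by positivity), Real.log_mul (by positivity) (pow_pos hq0 M).ne', Real.log_pow (n := M),
          hlogq]; ring
      rw [hL, hRlog] at h
      linarith [h]
    -- `-log(1-x) ≥ x`, `√M ≤ √2 √M`
    have hlog2 : x ≤ -Real.log (1 - x) := by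
      have := Real.log_le_sub_one_of_pos (show 0 < 1 - x by linarith); linarith
    have hsq : Real.sqrt (M : ℝ) ≤ Real.sqrt 2 * Real.sqrt M := by
      have h1 : (1 : ℝ) ≤ Real.sqrt 2 := Real.one_le_sqrt.2 (by norm_num)
      exact le_mul_of_one_le_left (Real.sqrt_nonneg _) h1
    have hlogP : Real.log P ≤ 6 * Real.log (2 * (N : ℝ) + 3) := by rw [hP, Real.log_pow]; push_cast; exact le_rfl
    set R : ℝ := 6 * Real.log (2 * (N : ℝ) + 3) + Real.log A with hR
    have hR0 : 0 ≤ R := by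
      have : 0 ≤ Real.log (2 * (N : ℝ) + 3) := Real.log_nonneg (by linarith); positivity
    have hmain : (M : ℝ) * x ≤ R + c * Real.sqrt 2 * Real.sqrt M := by
      have h1 : (M : ℝ) * x ≤ (M : ℝ) * -Real.log (1 - x) := mul_le_mul_of_nonneg_left hlog2 (by positivity)
      have h2 : c * Real.sqrt (M : ℝ) ≤ c * (Real.sqrt 2 * Real.sqrt M) := mul_le_mul_of_nonneg_left hsq hc
      linarith
    -- `R ≤ (36 + log A) t`
    have hRt : R ≤ (36 + Real.log A) * t := by
      have h1 : Real.log (2 * (N : ℝ) + 3) ≤ 3 * (2 * (N : ℝ) + 3) ^ ((1 : ℝ) / 3) := log_le_three_rpow_third (by linarith)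
      have h2 : (2 * (N : ℝ) + 3) ^ ((1 : ℝ) / 3) ≤ (5 * (N : ℝ)) ^ ((1 : ℝ) / 3) :=
        Real.rpow_le_rpow (by linarith) (by linarith) (by norm_num)
      have h3 := rpow_third_five_mul_le hN0.le
      have hLt : Real.log (2 * (N : ℝ) + 3) ≤ 6 * t := by rw [htdef]; linarith
      have h4 : Real.log A ≤ Real.log A * t := le_mul_of_one_le_right hlogA ht1
      rw [hR]; linarith
    have hMy' : u * N / (8 * B) ≤ M := by
      have : y / 2 = u * N / (8 * B) := by rw [hy]; exact aux_y u N B hB0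
      linarith
    -- case split on the dominant term
    have hut0 : 0 ≤ u * t := by positivity
    rcases le_or_gt ((M : ℝ) * x / 2) R with hA' | hB'
    · -- (A): `M x ≤ 2R` ⇒ `u² N ≤ 32 B μ² R ≤ KA · t`, so `(ut)² ≤ KA`
      have h1 : (M : ℝ) * x ≤ 2 * R := by linarith
      have h2 : u * N / (8 * B) * x ≤ 2 * R := le_trans (mul_le_mul_of_nonneg_right hMy' hx0.le) h1
      have h3 : u ^ 2 * N ≤ 32 * B * μ ^ 2 * R := by
        rw [hx, aux_A u N B μ hB0 hμ0, div_le_iff₀ (by positivity)] at h2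
        linarith
      have h4 : u ^ 2 * N ≤ KA * t := by
        rw [hKA]
        calc u ^ 2 * N ≤ 32 * B * μ ^ 2 * R := h3
          _ ≤ 32 * B * μ ^ 2 * ((36 + Real.log A) * t) := mul_le_mul_of_nonneg_left hRt (by positivity)
          _ = 32 * B * μ ^ 2 * (36 + Real.log A) * t := by ring
      have h5 : (u * t) ^ 2 ≤ KA := by
        have e : u ^ 2 * N = (u * t) ^ 2 * t := by rw [← ht3]; ring
        rw [e] at h4
        exact le_of_mul_le_mul_right h4 ht0
      have hKA1 : 1 ≤ max 1 KA := le_max_left _ _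
      exact (le_of_sq_le hut0 hKA1 (h5.trans (le_max_right _ _))).trans (le_max_left _ _)
    · -- (B): `M x/2 ≤ c√2 √M` ⇒ `M x² ≤ 8 c²` ⇒ `u³ N ≤ 256 B μ⁴ c²`, so `(ut)³ ≤ KB`
      have h1 : (M : ℝ) * x / 2 ≤ c * Real.sqrt 2 * Real.sqrt M := by linarith
      have hM0 : (0 : ℝ) < M := by linarith
      have hsM : Real.sqrt (M : ℝ) ^ 2 = M := Real.sq_sqrt hM0.le
      have hs2 : Real.sqrt (2 : ℝ) ^ 2 = 2 := Real.sq_sqrt (by norm_num)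
      have h2 : (M : ℝ) * x ^ 2 ≤ 8 * c ^ 2 := by
        have hl : 0 ≤ (M : ℝ) * x := by positivity
        have h3 : ((M : ℝ) * x) ^ 2 ≤ (2 * c * Real.sqrt 2 * Real.sqrt M) ^ 2 :=
          pow_le_pow_left₀ hl (by linarith) 2
        have e : (2 * c * Real.sqrt 2 * Real.sqrt (M : ℝ)) ^ 2 = 8 * c ^ 2 * M := by
          have : (2 * c * Real.sqrt 2 * Real.sqrt (M : ℝ)) ^ 2 = 4 * c ^ 2 * Real.sqrt 2 ^ 2 * Real.sqrt (M : ℝ) ^ 2 := by ring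
          rw [this, hs2, hsM]; ring
        rw [e] at h3
        have e2 : ((M : ℝ) * x) ^ 2 = (M : ℝ) * ((M : ℝ) * x ^ 2) := by ring
        rw [e2] at h3
        have h4 : (M : ℝ) * ((M : ℝ) * x ^ 2) ≤ (M : ℝ) * (8 * c ^ 2) := by linarith
        exact le_of_mul_le_mul_left h4 hM0
      have h3 : u ^ 3 * N ≤ KB := by
        have h4 : u * N / (8 * B) * x ^ 2 ≤ 8 * c ^ 2 :=
          le_trans (mul_le_mul_of_nonneg_right hMy' (by positivity)) h2
        rw [hx, aux_B u N B μ hB0 hμ0, div_le_iff₀ (by positivity)] at h4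
        rw [hKB]; linarith
      have h5 : (u * t) ^ 3 ≤ KB := by
        have e : u ^ 3 * N = (u * t) ^ 3 := by rw [← ht3]; ring
        rw [e] at h3; exact h3
      have hKB1 : 1 ≤ max 1 KB := le_max_left _ _
      have := le_of_cube_le hut0 hKB1 (h5.trans (le_max_right _ _))
      exact this.trans (max_le hK1 hKB_le)

end KestenRateLower

end Literature.Probability.RandomPlanarGeometry.SAW.Zd
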